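import Mathlib
import Literature.AlgebraicGeometry.Resolution.CutkoskyTauTwoSequence
import HarnessLib

/-!
# Cutkosky 2009, Lemma 5.1: order and `τ` at the points of a permissible blow-up (named facts, statement only)

Topic: `Literature/AlgebraicGeometry/Resolution`.  S. D. Cutkosky, *Resolution of singularities for
3-folds in positive characteristic*, Amer. J. Math. **131** (2009) 59–127 [cite: Cutkosky2009], §5
"The `ν` and `τ` invariants", author version (held copy `paper:doi-10-1353-ajm-0-0036`; locator
"p. N l. M" = page N, line M of its text layer), p. 17 l. 8–54 and p. 18 l. 1–6:

> (p. 17 l. 8–20) "Suppose that `V` is a nonsingular variety over an algebraically closed field `k` of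
> arbitrary characteristic, and `𝓘` is a nonzero ideal sheaf of `V`. … `Sing_t(𝓘) = {p ∈ V | ν_p(𝓘) ≥ t}`
> … `r = max{t | Sing_t(𝓘) ≠ ∅} = max{ν_p(𝓘) | p ∈ V}`.  Suppose that `Y` is a nonsingular, integral
> subvariety of `V`.  Let `π_1 : V_1 → V` be the blow up of `Y` with exceptional divisor `F`.  Let
> `t = ν_q(𝓘_q)`, where `q` is the generic point of `Y`.  Then the weak transform `𝓘_1` of `𝓘` on
> `V_1` is defined by `𝓘𝒪_{V_1} = 𝒪_{V_1}(−tF)𝓘_1`."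
> (p. 17 l. 35–45) "Define `τ(p) = τ_𝓘(p)` to be the dimension of the smallest linear subspace `T` of
> the `k`-subspace spanned by `x_1, x_2, …, x_n` in `k⟦x_1, …, x_n⟧` such that `L ∈ k[T]` for all
> `f ∈ 𝓘_p`.  We will call the subvariety `M_p = V(T)` of `Spec(𝒪_{V,p})` an approximate manifold to
> `𝓘` at `p`. … It follows that if `Y ⊂ Sing_r(𝓘)` is a nonsingular subvariety with `p ∈ Y`, then
> there exists an approximate manifold `M_p` to `𝓘` at `p` such that the germ of `Y` at `p` is
> contained in `M_p`.
> **Lemma 5.1.** Suppose that `Y ⊂ Sing_r(𝓘)` is a nonsingular subvariety of `V`, `π_1 : V_1 → V` is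
> the blow up of `Y`, `𝓘_1` is the weak transform of `𝓘` on `V_1`, `p ∈ Y`, `M_p` is an approximate
> manifold to `𝓘` at `p` containing the germ of `Y` at `p`, and `q ∈ π_1^{-1}(p)`.  Then
> 1. `ν_q(𝓘_1) ≤ r`.
> 2. `ν_q(𝓘_1) = r` implies `q` is on the strict transform `M_p'` of `M_p` and `τ(p) ≤ τ(q)`.
> 3. Suppose that `ν_q(𝓘_1) = r` and `τ(p) = τ(q)`.  Then there exists an approximate manifold `M_q`
> to `𝓘` at `q` such that `M_q ∩ π_1^{-1}(p) = M_p' ∩ π_1^{-1}(p)` where `M_p'` is the strict transform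
> of `M_p` on `V_1`.
> *Proof.* This follows from a local calculation, as in Lemma 6.4 and Lemma 7.5 [C2]."
> (p. 18 l. 5–6) "With the hypotheses of Lemma 5.1, we immediately conclude that `τ(p) ≤ n − dim Y`
> and `τ(p) = n − dim Y` implies `ν_q(𝓘_1) < r`."

## The frame (that of `CutkoskySurfaceOmegaSequence.lean` / `CutkoskyTauTwoSequence.lean`)

`dim V = 3`, completed local rings `R = k⟦x, y, z⟧` (`MvPowerSeries (Fin 3) k`, `k = k̄`), a step
`R_p = R → R' = R_q` of completed local rings presented on regular systems of parameters `u` of `R`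
and `u'` of `R'` as the FIRST CHART of the blow-up with `q` its origin: for the blow-up of the closed
point `p`, `u 0 ↦ u' 0, u 1 ↦ u' 0 · u' 1, u 2 ↦ u' 0 · u' 2` (`IsPointChart`; `q` is the point
`ū_1 = ū_2 = 0` of the exceptional plane `ℙ(𝔪/𝔪²)ᵛ`, i.e. the tangent direction `∂/∂u_0`); for
the blow-up of the nonsingular curve `Y = V(u 0, u 1)`, `u 0 ↦ u' 0, u 1 ↦ u' 0 · u' 1, u 2 ↦ u' 2`
(`IsCurveChart`; `q` is the point `ū_1 = 0` of the fibre `ℙ¹` over `p`, the normal direction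
`∂/∂u_0`); `I'` is the weak transform `(1/(u' 0)^r)·I R'` (`IsWeakTransform`; the exponent is
`t = ν` at the generic point of the centre, `= r` here: `ν_p(I) = r`, resp. `Y ⊂ Sing_r(I)` and
`r = max ν`).  These three predicates merely NAME the two halves of the bodies of
`Cutkosky2009.IsPointStep` / `IsCurveStep` (`isPointStep_iff`, `isCurveStep_iff`, proved).  Since
`k = k̄`, every closed point of the exceptional fibre is the origin of the first chart for a suitable
`u`, so the chart form loses nothing.  READING OF "`q` is on the strict transform `M_p'`": the strict
transform of the hypersurface `V(ℓ)` (`ℓ ∈ 𝔪 ∖ 𝔪²`) meets the exceptional plane in the line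
`ℓ̄ = 0`, which contains the point `ū_1 = ū_2 = 0` iff `ℓ ∈ (u 1, u 2) + 𝔪²`; the strict transform
of the curve `V(w 0, w 1)` meets it in the point `w̄_0 = w̄_1 = 0`, which is `q` iff
`w 0, w 1 ∈ (u 1, u 2) + 𝔪²`; under the blow-up of `Y = V(u 0, u 1)`, the strict transform of
`V(ℓ) ⊇ Y` (`ℓ ∈ (u 0, u 1)`, `ℓ ∉ 𝔪²`) passes through the origin of the `u 0`-chart iff the
`ū_0`-coefficient of `ℓ̄` vanishes, i.e. `ℓ ∈ (u 1) + 𝔪²`.  `ν`, `Sing_r`, `τ = 1, 2, 3` are the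
expansion-free `Cutkosky2009.HasOrder`, `InSingR`, `TauOne`, `TauTwo` / `TauLETwo`, `TauThree`.

## What is typed (two named facts, statement only; NOT proved here) and what is proved

* `Cutkosky2009_Lemma5_1` — Lemma 5.1 (1) and (2) for both kinds of centre in the chart frame:
  (1) `ν_q(I_1) ≤ r`; (2) if `ν_q(I_1) = r` then `q ∈ M_p'` for the approximate manifold — the
  approximate hyperplane `V(ℓ)` when `τ(p) = 1` (`I ⊆ (ℓ^r) + 𝔪^{r+1}`), the approximate line
  `V(w 0, w 1)` when `τ(p) = 2` (`I ⊆ (w 0, w 1)^r + 𝔪^{r+1}`; guarded by `TauTwo I r` since rev. 2: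
  `T` must be the SMALLEST such subspace, p. 17 l. 35–40) — and `τ(p) ≤ τ(q)` (as
  `(τ(p) = 2 ⇒ τ(q) ≠ 1) ∧ (τ(p) = 3 ⇒ τ(q) = 3)`, the values being `1, 2, 3`).  Part (3) (transport
  of approximate manifolds) is NOT typed.
* `Cutkosky2009_Lemma5_1_dimCount` — the consequence p. 18 l. 5–6 with `n = 3`: a nonsingular curve of
  `Sing_r(I)` through `p` forces `τ(p) ≤ 2`; `τ(p) = 3` ⇒ the order drops at every point of the
  blown-up point; `τ(p) = 2` ⇒ the order drops at every point over `p` of the blown-up curve.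
* PROVED: `isPointStep_iff`, `isCurveStep_iff` (bookkeeping), and the corollaries over the step
  predicates of the chains — `Cutkosky2009_L5_1_orderLE`, `Cutkosky2009_L5_1_tauMono` (from the first
  fact), `Cutkosky2009_L5_1_tauThree`, `Cutkosky2009_L5_1_tauTwoCurve`,
  `Cutkosky2009_L5_1_tauLETwo_of_curve` (from the second) — the forms requested by the `τ`-constant
  reductions of (11) (p. 25 l. 37–38 "By Lemma 5.1, `τ(q_n) ≥ τ(q_{n−1})`"; p. 25 l. 44 "The case
  where `τ(q) = 3` is immediate from Lemma 5.1"; §9 p. 27 l. 46–49).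

## Scope (honest)

Statement only: the printed proof is "a local calculation, as in Lemma 6.4 and Lemma 7.5 [C2]"
(Cutkosky, *Resolution of Singularities*, GSM 63, 2004 — not held; acq-13350); elementary leading-form
calculus under `x = x_1 z_1, y = y_1 z_1`, plausibly provable in the tree without [C2], not done here.
`k` algebraically closed and `dim V = 3` as printed (the lemma is printed for any `n`; only `n = 3` is
typed — `-- TODO(general form)`).  Lemma 5.2 (the shape of `F ∩ Sing_r(I_1)`) is GLOBAL on the
exceptional divisor and is carried by the chains as hypothesis fields (`TauOneChain.singR_curve /
singR_unique`, `TauTwoChain.singR_point`), not typed as a fact; Lemma 5.3 (approximate hypersurfaces)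
is not typed.  AI transcription of the text layer of the held copy; weaker than expert review.

## Sources

* S. D. Cutkosky, Amer. J. Math. 131 (2009): §5 p. 17 l. 8–54 (setting, `τ`, approximate manifolds,
  Lemma 5.1), p. 18 l. 5–6 (the dimension count); (11) p. 25 l. 20–45; §9 p. 27 l. 46–49; Def. 10.10
  p. 31 l. 36 – p. 32 l. 4 (Tr1–Tr4, the charts). [Cutkosky2009]
-/

-- TODO(general form): Lemma 5.1 is printed for a nonsingular `n`-fold; only `n = 3` is typed.

noncomputable section

open IsLocalRing

namespace Literature.AlgebraicGeometry.Resolution.Cutkosky2009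

universe u

/-! ## `τ(I) = 3` and the chart presentations -/
section Local
variable {R : Type u} [CommRing R] [IsLocalRing R]

/-- `τ(I) = 3` for an ideal of order exactly `r ≥ 1` in a `3`-dimensional regular local ring: no plane
`k ū_0 ⊕ k ū_1` contains all `r`-leading forms (`¬ TauLETwo`; the values of `τ` being `1, 2, 3`).
[cite: Cutkosky2009, §5 p. 17 l. 35–38] -/
def TauThree (I : Ideal R) (r : ℕ) : Prop := ¬ TauLETwo I r

/-- `τ = 3` excludes `τ = 2`. [cite: Cutkosky2009, §5 p. 17 l. 35–38] -/
theorem TauThree.not_tauTwo {I : Ideal R} {r : ℕ} (h : TauThree I r) : ¬ TauTwo I r :=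
  fun h2 => h h2.1

end Local

section Charts
variable {k : Type u} [Field k]

/-- `u, u'` present `φ : R → R'` as the first chart of the blow-up of the CLOSED POINT, the point `q`
of `R'` being its origin: `u 0 ↦ u' 0`, `u 1 ↦ u' 0 · u' 1`, `u 2 ↦ u' 0 · u' 2` (Tr1/Tr2 of
Def. 10.10 up to the choice of parameters). [cite: Cutkosky2009, Def. 10.10 p. 31 l. 36 – p. 32 l. 4] -/
def IsPointChart (φ : MvPowerSeries (Fin 3) k →ₐ[k] MvPowerSeries (Fin 3) k)
    (u u' : Fin 3 → MvPowerSeries (Fin 3) k) : Prop :=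
  IsParams u ∧ IsParams u' ∧ φ (u 0) = u' 0 ∧ φ (u 1) = u' 0 * u' 1 ∧ φ (u 2) = u' 0 * u' 2

/-- `u, u'` present `φ : R → R'` as the first chart of the blow-up of the NONSINGULAR CURVE
`Y = V(u 0, u 1)`, `q` its origin: `u 0 ↦ u' 0`, `u 1 ↦ u' 0 · u' 1`, `u 2 ↦ u' 2` (Tr3/Tr4 of
Def. 10.10 up to the choice of parameters). [cite: Cutkosky2009, Def. 10.10 p. 31 l. 36 – p. 32 l. 4] -/
def IsCurveChart (φ : MvPowerSeries (Fin 3) k →ₐ[k] MvPowerSeries (Fin 3) k)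
    (u u' : Fin 3 → MvPowerSeries (Fin 3) k) : Prop :=
  IsParams u ∧ IsParams u' ∧ φ (u 0) = u' 0 ∧ φ (u 1) = u' 0 * u' 1 ∧ φ (u 2) = u' 2

/-- `I'` is the weak transform `(1/x^r)·I R'` of `I` under `φ : R → R'` ("`𝓘𝒪_{V_1} = 𝒪_{V_1}(−tF)𝓘_1`",
`x` a local equation of `F`, here `t = r`). [cite: Cutkosky2009, §5 p. 17 l. 17–20; Def. 10.10 p. 32 l. 1–4] -/
def IsWeakTransform (I I' : Ideal (MvPowerSeries (Fin 3) k))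
    (φ : MvPowerSeries (Fin 3) k →ₐ[k] MvPowerSeries (Fin 3) k) (x : MvPowerSeries (Fin 3) k)
    (r : ℕ) : Prop :=
  I.map φ ≤ Ideal.span {x ^ r} ∧ I' = (I.map φ).colon (Ideal.span {x ^ r})

/-- `IsPointStep` unpacked: a point chart presentation and the weak transform.
[cite: Cutkosky2009, Def. 10.10 p. 31 l. 36 – p. 32 l. 4] -/
theorem isPointStep_iff {I I' : Ideal (MvPowerSeries (Fin 3) k)}
    {φ : MvPowerSeries (Fin 3) k →ₐ[k] MvPowerSeries (Fin 3) k} {r : ℕ} :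
    IsPointStep I I' φ r ↔ ∃ u u', IsPointChart φ u u' ∧ IsWeakTransform I I' φ (u' 0) r := by
  constructor
  · rintro ⟨u, u', h1, h2, h3, h4, h5, h6, h7⟩
    exact ⟨u, u', ⟨h1, h2, h3, h4, h5⟩, h6, h7⟩
  · rintro ⟨u, u', ⟨h1, h2, h3, h4, h5⟩, h6, h7⟩
    exact ⟨u, u', h1, h2, h3, h4, h5, h6, h7⟩

/-- `IsCurveStep` unpacked: a curve chart presentation along `P = (u 0, u 1)` and the weak transform.
[cite: Cutkosky2009, Def. 10.10 p. 31 l. 36 – p. 32 l. 4] -/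
theorem isCurveStep_iff {I I' : Ideal (MvPowerSeries (Fin 3) k)}
    {φ : MvPowerSeries (Fin 3) k →ₐ[k] MvPowerSeries (Fin 3) k} {r : ℕ}
    {P : Ideal (MvPowerSeries (Fin 3) k)} :
    IsCurveStep I I' φ r P ↔
      ∃ u u', IsCurveChart φ u u' ∧ P = Ideal.span {u 0, u 1} ∧ IsWeakTransform I I' φ (u' 0) r := by
  constructor
  · rintro ⟨u, u', h1, h2, hP, h3, h4, h5, h6, h7⟩
    exact ⟨u, u', ⟨h1, h2, h3, h4, h5⟩, hP, h6, h7⟩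
  · rintro ⟨u, u', ⟨h1, h2, h3, h4, h5⟩, hP, h6, h7⟩
    exact ⟨u, u', h1, h2, hP, h3, h4, h5, h6, h7⟩

end Charts

/-! ## The named facts -/

/-- **Cutkosky 2009, Lemma 5.1 (1), (2)** (named fact, statement only), `dim V = 3`, `k = k̄`, in the
chart frame: for an ideal `I ⊂ R = k⟦x, y, z⟧` of order exactly `r ≥ 1` at `p` and the weak transform
`I'` at a point `q` over `p` —
POINT blow-up (`u, u'` a point chart, `q` its origin): (1) `ν_q(I') ≤ r`; (2) if `ν_q(I') = r` then
`q` lies on the strict transform of the approximate manifold `M_p = V(T)`, `T` the SMALLEST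
subspace with all leading forms in `k[T]` (p. 17 l. 35–40): when `τ(p) = 1`, of the approximate
hyperplane `V(ℓ)` (`ℓ ∈ 𝔪 ∖ 𝔪²`, `I ⊆ (ℓ^r) + 𝔪^{r+1}`; such `T = kℓ̄` is unique): `ℓ ∈ (u 1, u 2) + 𝔪²`;
when `τ(p) = 2`, of the approximate line `V(w 0, w 1)` (`w` a regular system,
`I ⊆ (w 0, w 1)^r + 𝔪^{r+1}`; then `span(w̄₀, w̄₁) = T`): `w 0, w 1 ∈ (u 1, u 2) + 𝔪²` (rev. 2: this
clause is guarded by `τ(p) = 2` — for `τ(p) = 1` a plane through `T` is NOT an approximate manifold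
and the unguarded clause is false, witness `I = (x)`, `y`-chart; lane-B res-ref-b10); and `τ(p) ≤ τ(q)`.
CURVE blow-up along `Y = V(u 0, u 1) ⊂ Sing_r(I)` (`ν = r` at its generic point, as `r = max ν`):
(1) `ν_q(I') ≤ r`; (2) if `ν_q(I') = r` then `q` lies on the strict transform of every approximate
hyperplane `V(ℓ) ⊇ Y` (`ℓ ∈ (u 0, u 1)`, `ℓ ∉ 𝔪²`, `I ⊆ (ℓ^r) + 𝔪^{r+1}`): `ℓ ∈ (u 1) + 𝔪²`; and
`τ(p) ≤ τ(q)`.  Part (3) is not typed.  Printed proof: "a local calculation, as in Lemma 6.4 and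
Lemma 7.5 [C2]".  NOT proved here. [cite: Cutkosky2009, Lemma 5.1 p. 17 l. 46–54; p. 17 l. 8–20, l. 35–45] -/
def _root_.Literature.AlgebraicGeometry.Resolution.Cutkosky2009_Lemma5_1 : Prop :=
  ∀ (k : Type) [Field k] [IsAlgClosed k] (r : ℕ) (I I' : Ideal (MvPowerSeries (Fin 3) k))
    (φ : MvPowerSeries (Fin 3) k →ₐ[k] MvPowerSeries (Fin 3) k) (u u' : Fin 3 → MvPowerSeries (Fin 3) k),
    1 ≤ r → HasOrder I r → IsWeakTransform I I' φ (u' 0) r →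
    (IsPointChart φ u u' →
      ¬ I' ≤ maximalIdeal (MvPowerSeries (Fin 3) k) ^ (r + 1) ∧
      (HasOrder I' r → ∀ ℓ : MvPowerSeries (Fin 3) k, ℓ ∈ maximalIdeal (MvPowerSeries (Fin 3) k) → ℓ ∉ maximalIdeal (MvPowerSeries (Fin 3) k) ^ 2 →
        I ≤ Ideal.span {ℓ ^ r} ⊔ maximalIdeal (MvPowerSeries (Fin 3) k) ^ (r + 1) →
          ℓ ∈ Ideal.span {u 1, u 2} ⊔ maximalIdeal (MvPowerSeries (Fin 3) k) ^ 2) ∧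
      (HasOrder I' r → TauTwo I r → ∀ w : Fin 3 → MvPowerSeries (Fin 3) k, IsParams w →
        I ≤ Ideal.span {w 0, w 1} ^ r ⊔ maximalIdeal (MvPowerSeries (Fin 3) k) ^ (r + 1) →
          w 0 ∈ Ideal.span {u 1, u 2} ⊔ maximalIdeal (MvPowerSeries (Fin 3) k) ^ 2 ∧
            w 1 ∈ Ideal.span {u 1, u 2} ⊔ maximalIdeal (MvPowerSeries (Fin 3) k) ^ 2) ∧
      (HasOrder I' r → (TauTwo I r → ¬ TauOne I' r) ∧ (TauThree I r → TauThree I' r))) ∧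
    (IsCurveChart φ u u' → InSingR I r (Ideal.span {u 0, u 1}) →
      ¬ InSingR I (r + 1) (Ideal.span {u 0, u 1}) →
      ¬ I' ≤ maximalIdeal (MvPowerSeries (Fin 3) k) ^ (r + 1) ∧
      (HasOrder I' r → ∀ ℓ : MvPowerSeries (Fin 3) k, ℓ ∈ Ideal.span {u 0, u 1} →
        ℓ ∉ maximalIdeal (MvPowerSeries (Fin 3) k) ^ 2 → I ≤ Ideal.span {ℓ ^ r} ⊔ maximalIdeal (MvPowerSeries (Fin 3) k) ^ (r + 1) →
          ℓ ∈ Ideal.span {u 1} ⊔ maximalIdeal (MvPowerSeries (Fin 3) k) ^ 2) ∧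
      (HasOrder I' r → (TauTwo I r → ¬ TauOne I' r) ∧ (TauThree I r → TauThree I' r)))

/-- **Cutkosky 2009, the dimension count after Lemma 5.1** (named fact, statement only), `n = 3`,
`k = k̄`: "`τ(p) ≤ n − dim Y` and `τ(p) = n − dim Y` implies `ν_q(𝓘_1) < r`" — for an ideal
`I ⊂ k⟦x, y, z⟧` of order exactly `r ≥ 1`: a nonsingular curve `V(u 0, u 1)` of `Sing_r(I)` through
`p` forces `τ(p) ≤ 2`; if `τ(p) = 3`, the weak transform under the blow-up of `p` has order `≠ r`
(so `< r`, by Lemma 5.1 (1)) at every point over `p`; if `τ(p) = 2`, the weak transform under the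
blow-up of a nonsingular curve of `Sing_r(I)` through `p` (`ν = r` at its generic point) has order
`≠ r` at every point over `p`.  NOT proved here. [cite: Cutkosky2009, p. 18 l. 5–6; Lemma 5.1 p. 17 l. 46–54] -/
def _root_.Literature.AlgebraicGeometry.Resolution.Cutkosky2009_Lemma5_1_dimCount : Prop :=
  ∀ (k : Type) [Field k] [IsAlgClosed k] (r : ℕ) (I : Ideal (MvPowerSeries (Fin 3) k)),
    1 ≤ r → HasOrder I r →
    (∀ u : Fin 3 → MvPowerSeries (Fin 3) k, IsParams u → InSingR I r (Ideal.span {u 0, u 1}) →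
      TauLETwo I r) ∧
    (∀ (I' : Ideal (MvPowerSeries (Fin 3) k)) (φ : MvPowerSeries (Fin 3) k →ₐ[k] MvPowerSeries (Fin 3) k)
      (u u' : Fin 3 → MvPowerSeries (Fin 3) k), IsWeakTransform I I' φ (u' 0) r →
      (IsPointChart φ u u' → TauThree I r → ¬ HasOrder I' r) ∧
      (IsCurveChart φ u u' → InSingR I r (Ideal.span {u 0, u 1}) →
        ¬ InSingR I (r + 1) (Ideal.span {u 0, u 1}) → TauTwo I r → ¬ HasOrder I' r))

/-! ## Corollaries over the step predicates of the chains (proved from the facts) -/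
section Corollaries
variable {k : Type} [Field k] [IsAlgClosed k] {r : ℕ} {I I' : Ideal (MvPowerSeries (Fin 3) k)}
  {φ : MvPowerSeries (Fin 3) k →ₐ[k] MvPowerSeries (Fin 3) k}

/-- Lemma 5.1 (1) along a step of (11): `ν_q(I_1) ≤ r` (point step, or curve step along a nonsingular
curve of `Sing_r` with `ν = r` at its generic point). [cite: Cutkosky2009, Lemma 5.1 (1) p. 17 l. 49] -/
theorem Cutkosky2009_L5_1_orderLE (h : Cutkosky2009_Lemma5_1) (hr : 1 ≤ r) (hI : HasOrder I r)
    (hstep : IsPointStep I I' φ r ∨ ∃ P, InSingR I r P ∧ ¬ InSingR I (r + 1) P ∧ IsCurveStep I I' φ r P) :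
    ¬ I' ≤ maximalIdeal (MvPowerSeries (Fin 3) k) ^ (r + 1) := by
  rcases hstep with hpt | ⟨P, hP, hP', hcv⟩
  · obtain ⟨u, u', hch, hwt⟩ := isPointStep_iff.mp hpt
    exact ((h k r I I' φ u u' hr hI hwt).1 hch).1
  · obtain ⟨u, u', hch, rfl, hwt⟩ := isCurveStep_iff.mp hcv
    exact ((h k r I I' φ u u' hr hI hwt).2 hch hP hP').1

/-- **Lemma 5.1 (2) along a step of (11): `τ(q_n) ≥ τ(q_{n−1})`** (p. 25 l. 37–38), as
`(τ = 2 ⇒ τ' ≠ 1) ∧ (τ = 3 ⇒ τ' = 3)`. [cite: Cutkosky2009, Lemma 5.1 (2) p. 17 l. 50; p. 25 l. 37–38] -/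
theorem Cutkosky2009_L5_1_tauMono (h : Cutkosky2009_Lemma5_1) (hr : 1 ≤ r) (hI : HasOrder I r)
    (hstep : IsPointStep I I' φ r ∨ ∃ P, InSingR I r P ∧ ¬ InSingR I (r + 1) P ∧ IsCurveStep I I' φ r P)
    (hI' : HasOrder I' r) : (TauTwo I r → ¬ TauOne I' r) ∧ (TauThree I r → TauThree I' r) := by
  rcases hstep with hpt | ⟨P, hP, hP', hcv⟩
  · obtain ⟨u, u', hch, hwt⟩ := isPointStep_iff.mp hpt
    exact ((h k r I I' φ u u' hr hI hwt).1 hch).2.2.2 hI'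
  · obtain ⟨u, u', hch, rfl, hwt⟩ := isCurveStep_iff.mp hcv
    exact ((h k r I I' φ u u' hr hI hwt).2 hch hP hP').2.2 hI'

/-- **"The case where `τ(q) = 3` is immediate from Lemma 5.1"** (p. 25 l. 44): after the blow-up of a
point with `τ = 3` no point over it has order `r`. [cite: Cutkosky2009, p. 18 l. 5–6; p. 25 l. 44] -/
theorem Cutkosky2009_L5_1_tauThree (h : Cutkosky2009_Lemma5_1_dimCount) (hr : 1 ≤ r)
    (hI : HasOrder I r) (h3 : TauThree I r) (hstep : IsPointStep I I' φ r) : ¬ HasOrder I' r := by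
  obtain ⟨u, u', hch, hwt⟩ := isPointStep_iff.mp hstep
  exact ((h k r I hr hI).2 I' φ u u' hwt).1 hch h3

/-- **`τ = 2` and a curve blown up ⇒ the order drops** (the step excluded at §9 p. 27 l. 46–49).
[cite: Cutkosky2009, p. 18 l. 5–6; §9 p. 27 l. 46–49] -/
theorem Cutkosky2009_L5_1_tauTwoCurve (h : Cutkosky2009_Lemma5_1_dimCount) (hr : 1 ≤ r)
    (hI : HasOrder I r) (h2 : TauTwo I r) {P : Ideal (MvPowerSeries (Fin 3) k)} (hP : InSingR I r P)
    (hP' : ¬ InSingR I (r + 1) P) (hstep : IsCurveStep I I' φ r P) : ¬ HasOrder I' r := by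
  obtain ⟨u, u', hch, rfl, hwt⟩ := isCurveStep_iff.mp hstep
  exact ((h k r I hr hI).2 _ φ u u' hwt).2 hch hP hP' h2

/-- **`τ(p) ≤ n − dim Y`**: a nonsingular curve of `Sing_r(I)` through `p` forces `τ(p) ≤ 2`.
[cite: Cutkosky2009, p. 18 l. 5–6] -/
theorem Cutkosky2009_L5_1_tauLETwo_of_curve (h : Cutkosky2009_Lemma5_1_dimCount) (hr : 1 ≤ r)
    (hI : HasOrder I r) {u : Fin 3 → MvPowerSeries (Fin 3) k} (hu : IsParams u)
    (hP : InSingR I r (Ideal.span {u 0, u 1})) : TauLETwo I r :=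
  (h k r I hr hI).1 u hu hP

end Corollaries

end Literature.AlgebraicGeometry.Resolution.Cutkosky2009
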